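import Mathlib.CategoryTheory.Functor.FullyFaithful
import Mathlib.CategoryTheory.Iso
import HarnessLib

/-!
# Frobenioids I: subcategories given by object and arrow predicates

A small piece of category-theoretic bookkeeping used from §2 on (Mochizuki, *The geometry of
Frobenioids I*, Kyushu J. Math. **62** (2008)): a *subcategory* `P ⊆ C` that is neither full nor wide
— e.g. a base-section `P ⊆ C^pl-bk ⊆ C` (Def. 2.7 (i), kurims p. 51) or `C^Fr-tr ⊆ C` "determined by
the Frobenius-trivial objects and isometric morphisms" (Thm. 5.1 (iii), p. 97) — rendered as a pair
(object predicate, arrow predicate) closed under identities and composition, with its category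
structure and inclusion functor; "`P` is a skeleton" (§0 p. 15) for such a `P`.
[cite: MochizukiFrdI2008, Def. 2.7(i) p.51]
-/

namespace Literature.AlgebraicGeometry.Frobenioids

open CategoryTheory

universe v' u'

/-- A subcategory `P ⊆ C` given by a class of objects and a class of arrows between them, closed
under identities and composition (the shape of a base-section, Def. 2.7 (i), and of `C^Fr-tr`,
Thm. 5.1 (iii)). [cite: MochizukiFrdI2008, Def. 2.7(i) p.51] -/
structure Presection (C : Type u') [Category.{v'} C] : Type (max u' v') where
  /-- the objects of `P` -/
  obj : C → Prop
  /-- the arrows of `P` -/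
  hom : ∀ {A B : C}, (A ⟶ B) → Prop
  /-- arrows of `P` go between objects of `P` -/
  obj_of_hom : ∀ {A B : C} (f : A ⟶ B), hom f → obj A ∧ obj B
  /-- identities of objects of `P` lie in `P` -/
  hom_id : ∀ {A : C}, obj A → hom (𝟙 A)
  /-- `P` is closed under composition -/
  hom_comp : ∀ {X Y Z : C} (f : X ⟶ Y) (g : Y ⟶ Z), hom f → hom g → hom (f ≫ g)

namespace Presection

variable {C : Type u'} [Category.{v'} C] (P : Presection C)

/-- The objects of the subcategory `P` as a type. [cite: MochizukiFrdI2008, Def. 2.7(i) p.51] -/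
def Cat : Type u' := {A : C // P.obj A}

/-- The subcategory `P` as a category. [cite: MochizukiFrdI2008, Def. 2.7(i) p.51] -/
instance instCategory : Category.{v'} P.Cat where
  Hom A B := {f : A.1 ⟶ B.1 // P.hom f}
  id A := ⟨𝟙 A.1, P.hom_id A.2⟩
  comp f g := ⟨f.1 ≫ g.1, P.hom_comp _ _ f.2 g.2⟩
  id_comp _ := Subtype.ext (Category.id_comp _)
  comp_id _ := Subtype.ext (Category.comp_id _)
  assoc _ _ _ := Subtype.ext (Category.assoc _ _ _)

/-- Extensionality for arrows of `P`. [cite: MochizukiFrdI2008, Def. 2.7(i) p.51] -/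
@[ext] theorem hom_ext {A B : P.Cat} {f g : A ⟶ B} (h : f.1 = g.1) : f = g := Subtype.ext h

/-- Components of identities. [cite: MochizukiFrdI2008, Def. 2.7(i) p.51] -/
@[simp] theorem id_val (A : P.Cat) : (𝟙 A : A ⟶ A).1 = 𝟙 A.1 := rfl

/-- Components of composites. [cite: MochizukiFrdI2008, Def. 2.7(i) p.51] -/
@[simp] theorem comp_val {X Y Z : P.Cat} (f : X ⟶ Y) (g : Y ⟶ Z) : (f ≫ g).1 = f.1 ≫ g.1 := rfl

/-- The inclusion functor `P ↪ C`. [cite: MochizukiFrdI2008, Def. 2.7(i) p.51] -/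
def ι : P.Cat ⥤ C where
  obj A := A.1
  map f := f.1

/-- The inclusion `P ↪ C` is faithful. [cite: MochizukiFrdI2008, Def. 2.7(i) p.51] -/
instance ι_faithful : P.ι.Faithful where
  map_injective h := Subtype.ext h

/-- `P` "is a skeleton" (§0 p. 15): objects of `P` isomorphic in `P` are equal.
[cite: MochizukiFrdI2008, Def. 2.7(i) p.51] -/
def IsSkeleton : Prop := ∀ A B : P.Cat, Nonempty (A ≅ B) → A = B

/-- An isomorphism of `C` both of whose directions lie in `P` gives an isomorphism in `P`.
[cite: MochizukiFrdI2008, Def. 2.7(i) p.51] -/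
def isoMk {A B : P.Cat} (e : A.1 ≅ B.1) (h₁ : P.hom e.hom) (h₂ : P.hom e.inv) : A ≅ B where
  hom := ⟨e.hom, h₁⟩
  inv := ⟨e.inv, h₂⟩
  hom_inv_id := Subtype.ext e.hom_inv_id
  inv_hom_id := Subtype.ext e.inv_hom_id

end Presection

end Literature.AlgebraicGeometry.Frobenioids
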